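import Summits.CriticalPhenomena.PercolationContinuityZ3.Theorems.PercNearOneGluingNoHeavyLowerTailThreePointVarianceTwoNeighbours
import Summits.CriticalPhenomena.PercolationContinuityZ3.Theorems.PercNearOneGluingAdditiveGluingOneBond
import HarnessLib

/-!
# The two-neighbour reduction for `(3PT)` — measure-theoretic tools (two-bond decomposition, null sets)

Support file for crux `stmt-CriticalPhenomena-4575` (`NoHeavyLowerTail`), seat `prim-l12-p1` gen 18
(`--supports stmt-CriticalPhenomena-4575`).  Memo `run/shared/lean/prim/prim-l12/FROM-prim-l12-p1-g18-FACET-PRINCIPLE.md` §4.6.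

Generic lemmas for `prodBernoulli` on the pairs of `Fin n`, used by `…ThreePointVarianceTwoNeighbourReduction`:
`real_bilinear` (the probability of any event is the bilinear interpolation of its four corner values in two weights —
from the landed one-bond decomposition `stub_oneBondDecomp_k15`), the null set of pairs at `c` outside `{v,d}`
(`real_badvd`), and bookkeeping off a null set (`real_eq_of_agree_off_null`, `real_le_of_subset_off_null`, …). [this work]
-/

namespace Summit.CriticalPhenomena.PercolationContinuityZ3.Theorems.ThreePointVarianceTwoNeighbourTools

open MeasureTheory Set
open Literature.Probability.Percolation Literature.Probability.LatticeModels
open Summit.CriticalPhenomena.PercolationContinuityZ3.Theorems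
open Summit.CriticalPhenomena.PercolationContinuityZ3.Theorems.ThreePointVarianceTwoNeighbours

variable {n : ℕ}

/-! ### Bilinearity in two weights -/

/-- **Two-bond decomposition.** For pairs `e₁ ≠ e₂` and any event `S`, the probability under the weights
`w[e₁ ↦ r][e₂ ↦ ρ]` is the bilinear interpolation of its four corner values. [folklore; from `stub_oneBondDecomp_k15`] -/
theorem real_bilinear (w : Sym2 (Fin n) → unitInterval) {e₁ e₂ : Sym2 (Fin n)} (he : e₁ ≠ e₂)
    (r ρ : unitInterval) (S : Set (BondConfig (Fin n))) :
    (prodBernoulli (Function.update (Function.update w e₁ r) e₂ ρ)).real S =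
      (1 - (r:ℝ)) * (1 - (ρ:ℝ)) * (prodBernoulli (Function.update (Function.update w e₁ 0) e₂ 0)).real S +
      (r:ℝ) * (1 - (ρ:ℝ)) * (prodBernoulli (Function.update (Function.update w e₁ 1) e₂ 0)).real S +
      (1 - (r:ℝ)) * (ρ:ℝ) * (prodBernoulli (Function.update (Function.update w e₁ 0) e₂ 1)).real S +
      (r:ℝ) * (ρ:ℝ) * (prodBernoulli (Function.update (Function.update w e₁ 1) e₂ 1)).real S := by
  -- split in `e₁`
  have h1 := stub_oneBondDecomp_k15 n (Function.update (Function.update w e₁ r) e₂ ρ) e₁ S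
  have ev1 : (Function.update (Function.update w e₁ r) e₂ ρ) e₁ = r := by
    rw [Function.update_of_ne he, Function.update_self]
  have up1 : ∀ x : unitInterval, Function.update (Function.update (Function.update w e₁ r) e₂ ρ) e₁ x =
      Function.update (Function.update w e₁ x) e₂ ρ := by
    intro x
    rw [Function.update_comm he, Function.update_idem]
    exact Function.update_comm he.symm ρ x w
  rw [ev1, up1, up1] at h1
  -- split in `e₂`
  have h2 : ∀ x : unitInterval, (prodBernoulli (Function.update (Function.update w e₁ x) e₂ ρ)).real S =
      (1 - (ρ:ℝ)) * (prodBernoulli (Function.update (Function.update w e₁ x) e₂ 0)).real S +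
        (ρ:ℝ) * (prodBernoulli (Function.update (Function.update w e₁ x) e₂ 1)).real S := by
    intro x
    have h := stub_oneBondDecomp_k15 n (Function.update (Function.update w e₁ x) e₂ ρ) e₂ S
    rw [Function.update_self, Function.update_idem, Function.update_idem] at h
    exact h
  rw [h2 0, h2 1] at h1
  rw [h1]; ring

/-! ### Null sets and corner identities for a vertex `c` with neighbours `v, d` -/

section corners
variable {a b c v d : Fin n}

/-- The null event "some pair `s(c,x)`, `x ∉ {v,d}`, is open" has probability `0` when those pairs have weight `0`.
[this work] -/
theorem real_badvd (w' : Sym2 (Fin n) → unitInterval) (hw : ∀ x, x ≠ v → x ≠ d → (w' s(c, x) : ℝ) = 0) :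
    (prodBernoulli w').real {ω : BondConfig (Fin n) | ∃ x, x ≠ v ∧ x ≠ d ∧ s(c, x) ∈ ω} = 0 := by
  classical
  set F : Finset (Sym2 (Fin n)) := ((Finset.univ.erase v).erase d).image fun x => s(c, x) with hF
  have hsub : {ω : BondConfig (Fin n) | ∃ x, x ≠ v ∧ x ≠ d ∧ s(c, x) ∈ ω} = {ω | ∃ e ∈ F, e ∈ ω} := by
    ext ω
    simp only [hF, mem_setOf_eq, Finset.mem_image, Finset.mem_erase, Finset.mem_univ, and_true,
      exists_exists_and_eq_and]
    constructor
    · rintro ⟨x, hxv, hxd, hx⟩; exact ⟨x, ⟨hxd, hxv⟩, hx⟩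
    · rintro ⟨x, ⟨hxd, hxv⟩, hx⟩; exact ⟨x, hxv, hxd, hx⟩
  refine le_antisymm ?_ measureReal_nonneg
  rw [hsub]
  refine le_trans (prodBernoulli_real_exists_mem_le_sum w' F) (le_of_eq ?_)
  refine Finset.sum_eq_zero fun e he => ?_
  obtain ⟨x, hx, rfl⟩ := Finset.mem_image.1 he
  simp only [Finset.mem_erase, Finset.mem_univ, and_true] at hx
  exact hw x hx.2 hx.1

/-- A pair of weight `0` is almost surely closed. [folklore] -/
theorem real_mem_of_zero (w' : Sym2 (Fin n) → unitInterval) {e : Sym2 (Fin n)} (he : (w' e : ℝ) = 0) :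
    (prodBernoulli w').real {ω : BondConfig (Fin n) | e ∈ ω} = 0 := by
  rw [prodBernoulli_real_setOf_mem]; exact he

/-- A pair of weight `1` is almost surely open. [folklore] -/
theorem real_notMem_of_one (w' : Sym2 (Fin n) → unitInterval) {e : Sym2 (Fin n)} (he : (w' e : ℝ) = 1) :
    (prodBernoulli w').real {ω : BondConfig (Fin n) | e ∉ ω} = 0 := by
  rw [prodBernoulli_real_setOf_notMem, he]; ring

/-- Union of two null sets is null. [folklore] -/
theorem real_union_null (w' : Sym2 (Fin n) → unitInterval) {N₁ N₂ : Set (BondConfig (Fin n))}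
    (h₁ : (prodBernoulli w').real N₁ = 0) (h₂ : (prodBernoulli w').real N₂ = 0) :
    (prodBernoulli w').real (N₁ ∪ N₂) = 0 := by
  refine le_antisymm ?_ measureReal_nonneg
  calc (prodBernoulli w').real (N₁ ∪ N₂) ≤ (prodBernoulli w').real N₁ + (prodBernoulli w').real N₂ :=
        measureReal_union_le _ _
    _ = 0 := by rw [h₁, h₂]; ring

/-- Two events that agree off a null set have the same probability. [folklore] -/
theorem real_eq_of_agree_off_null (w' : Sym2 (Fin n) → unitInterval) {X Y N : Set (BondConfig (Fin n))}
    (hN : (prodBernoulli w').real N = 0) (h : ∀ ω, ω ∉ N → (ω ∈ X ↔ ω ∈ Y)) :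
    (prodBernoulli w').real X = (prodBernoulli w').real Y := by
  rw [← real_inter_compl_of_null w' hN X, ← real_inter_compl_of_null w' hN Y]
  congr 1
  ext ω
  simp only [mem_inter_iff, mem_compl_iff]
  constructor
  · rintro ⟨hx, hn⟩; exact ⟨(h ω hn).1 hx, hn⟩
  · rintro ⟨hy, hn⟩; exact ⟨(h ω hn).2 hy, hn⟩

/-- An event contained in another off a null set has smaller probability. [folklore] -/
theorem real_le_of_subset_off_null (w' : Sym2 (Fin n) → unitInterval) {X Y N : Set (BondConfig (Fin n))}
    (hN : (prodBernoulli w').real N = 0) (h : ∀ ω, ω ∉ N → ω ∈ X → ω ∈ Y) :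
    (prodBernoulli w').real X ≤ (prodBernoulli w').real Y := by
  rw [← real_inter_compl_of_null w' hN X, ← real_inter_compl_of_null w' hN Y]
  exact measureReal_mono fun ω hω => ⟨h ω hω.2 hω.1, hω.2⟩

end corners

end Summit.CriticalPhenomena.PercolationContinuityZ3.Theorems.ThreePointVarianceTwoNeighbourTools
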